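import Mathlib.MeasureTheory.Constructions.BorelSpace.Order
import Literature.NumberTheory.ConnesConsani2023.ZetaCycles
import Literature.NumberTheory.LFunctions.MuentzFormulaSchwartz
import HarnessLib

/-!
# ζ-cycles: Lemma 6.1 of Connes–Consani 2023 (scale-invariant Riemann sums of a function of bounded variation)

RH-FREE corpus literature (Connes–Consani 2023, *Spectral triples and ζ-cycles*, §6.1; cell rh-crit C1,
row t11).  Sequel of `ZetaCycles.lean`.  Everything here is PROVED; no new named facts.  This file
DISCHARGES the named fact `CC2023_lemma_6_1`.  Nothing in this file bears on the truth of RH.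

Lemma 6.1 (arXiv:2106.01715, p0018:L23–L58): for `f` of bounded variation on `(0, ∞)`, of rapid decay,
`O(u²)` at `0`, with `∫_0^∞ f = 0`:
(i) `𝓔(f)(u) = u^{1/2} Σ_{n ≥ 1} f(nu)` converges, is `O(u^{1/2})` at `0` and of rapid decay at `∞`;
(ii) `Σ_μ 𝓔(f)` converges and is a bounded measurable function on `ℝ₊^*/μ^ℤ`.

The heart of (i) is the Riemann-sum estimate of the printed proof (integration by parts in the
Stieltjes integral, p0018:L26–L48), done here cell by cell with the variation of `f` on each cell
`(nu, (n+1)u]`:  `|u f((n+1)u) − ∫_{cell} f| ≤ u · Var(f; cell)`, whence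
`|u Σ_{n ≥ 1} f(nu) − ∫_0^∞ f| ≤ u · Var(f; (0,∞))` and, since `∫_0^∞ f = 0`, `|Σ_{n≥1} f(nu)| ≤ Var(f; (0,∞))`.

## References

* A. Connes, C. Consani, *Spectral triples and ζ-cycles*, Enseign. Math. 69 (2023) 93–148,
  arXiv:2106.01715, §6.1, Lemma 6.1 [ConnesConsani2023].
-/

noncomputable section

open scoped Topology ENNReal NNReal
open Function Filter MeasureTheory Set Asymptotics
open Literature.NumberTheory.LFunctions

namespace Literature.NumberTheory.ConnesConsani2023.ZetaCycles

namespace RiemannSumHyp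

variable {f : ℝ → ℝ}

/-! ### (i), first clause: the series `Σ_{n ≥ 1} f(nu)` converges -/

/-- From an `O(x^{-k})` bound at `+∞` (`k ≥ 2`): constants `C ≥ 0`, `X ≥ 1` with `|f x| ≤ C / x^k` for
`x ≥ X`. [folklore] -/
private theorem exists_bound_of_decay (hf : RiemannSumHyp f) (k : ℕ) :
    ∃ C X : ℝ, 0 ≤ C ∧ 1 ≤ X ∧ ∀ x, X ≤ x → |f x| ≤ C / x ^ k := by
  obtain ⟨C, hC0, hC⟩ := (hf.decay k).exists_nonneg
  rw [IsBigOWith, eventually_atTop] at hC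
  obtain ⟨X, hX⟩ := hC
  refine ⟨C, max X 1, hC0, le_max_right _ _, fun x hx => ?_⟩
  have hx1 : 1 ≤ x := le_trans (le_max_right _ _) hx
  have hx0 : 0 < x := lt_of_lt_of_le zero_lt_one hx1
  have h := hX x (le_trans (le_max_left _ _) hx)
  rw [Real.norm_eq_abs, Real.norm_eq_abs, Real.rpow_neg hx0.le, Real.rpow_natCast,
    abs_of_pos (inv_pos.2 (pow_pos hx0 k))] at h
  simpa only [div_eq_mul_inv] using h

/-- **Lemma 6.1 (i), convergence**: for `u > 0` the series `Σ_{n ≥ 1} f(nu)` converges (absolutely; the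
terms are `O(n^{-2})` by the rapid decay of `f`). [cite: ConnesConsani2023, Lemma 6.1 (i) (arXiv chunk p0018:L23, L51–L54)] -/
theorem summable_comp_mul (hf : RiemannSumHyp f) {u : ℝ} (hu : 0 < u) :
    Summable fun n : ℕ => f (((n + 1 : ℕ) : ℝ) * u) := by
  obtain ⟨C, X, hC0, hX1, hb⟩ := hf.exists_bound_of_decay 2
  -- eventually `|f((n+1)u)| ≤ (C/u²) / (n+1)²`
  have hsum : Summable fun n : ℕ => C / u ^ 2 * (1 / (((n + 1 : ℕ) : ℝ)) ^ 2) := by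
    have h := (summable_nat_add_iff (f := fun n : ℕ => 1 / ((n : ℝ)) ^ 2) 1).mpr
      (Real.summable_one_div_nat_pow.mpr one_lt_two)
    exact h.mul_left _
  refine summable_of_isBigO_nat hsum ?_
  refine IsBigO.of_bound 1 ?_
  obtain ⟨N, hN⟩ := exists_nat_ge (X / u)
  filter_upwards [eventually_ge_atTop N] with n hn
  have hn1 : X ≤ (((n + 1 : ℕ) : ℝ)) * u := by
    have h1 : X / u ≤ ((n + 1 : ℕ) : ℝ) := le_trans hN (by exact_mod_cast Nat.le_succ_of_le hn)
    rwa [div_le_iff₀ hu] at h1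
  have hpos : 0 < (((n + 1 : ℕ) : ℝ)) * u := by positivity
  rw [Real.norm_eq_abs, one_mul, Real.norm_of_nonneg (by positivity)]
  calc |f ((((n + 1 : ℕ) : ℝ)) * u)| ≤ C / ((((n + 1 : ℕ) : ℝ)) * u) ^ 2 := hb _ hn1
    _ = C / u ^ 2 * (1 / (((n + 1 : ℕ) : ℝ)) ^ 2) := by
        rw [mul_pow]; field_simp

/-! ### The Riemann-sum estimate for functions of bounded variation -/

/-- Finitely many consecutive cells: `Σ_{n<N} Var(cell_n) = Var(f; (0,∞) ∩ [0, Nu])`. [folklore] -/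
private theorem sum_cellVar_eq {u : ℝ} (hu : 0 < u) (N : ℕ) :
    ∑ n ∈ Finset.range N, eVariationOn f (Ioi 0 ∩ Icc ((n : ℝ) * u) (((n : ℝ) + 1) * u)) = eVariationOn f (Ioi 0 ∩ Icc 0 ((N : ℝ) * u)) := by
  induction N with
  | zero =>
    simp only [Finset.range_zero, Finset.sum_empty, Nat.cast_zero, zero_mul]
    rw [eq_comm, eVariationOn.subsingleton]
    exact (subsingleton_Icc_of_ge le_rfl).anti inter_subset_right
  | succ N ih =>
    rw [Finset.sum_range_succ, ih, Nat.cast_succ]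
    by_cases hN : N = 0
    · subst hN
      simp only [Nat.cast_zero, zero_mul, zero_add, one_mul]
      rw [eVariationOn.subsingleton f ((subsingleton_Icc_of_ge le_rfl).anti inter_subset_right), zero_add]
    · exact eVariationOn.Icc_add_Icc f (by positivity) (by nlinarith) (by
        show (0 : ℝ) < (N : ℝ) * u
        have : 0 < (N : ℝ) := by exact_mod_cast Nat.pos_of_ne_zero hN
        positivity)

/-- Hence `Σ_n Var(cell_n) ≤ Var(f; (0,∞))`. [folklore] -/
private theorem tsum_cellVar_le {u : ℝ} (hu : 0 < u) :
    ∑' n : ℕ, eVariationOn f (Ioi 0 ∩ Icc ((n : ℝ) * u) (((n : ℝ) + 1) * u)) ≤ eVariationOn f (Ioi 0) :=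
  ENNReal.tsum_le_of_sum_range_le fun N => by
    rw [sum_cellVar_eq hu N]
    exact eVariationOn.mono f inter_subset_left

/-- **One cell** (the estimate `|∫_{nu}^{(n+1)u} ((n+1)u − t) df(t)| ≤ u ∫_{nu}^{(n+1)u} |df|` of the proof
of Lemma 6.1 (i), p0018:L32–L43, without Stieltjes integrals): for `u > 0`,
`|u f((n+1)u) − ∫_{(nu,(n+1)u]} f| ≤ u · Var(f; (0,∞) ∩ [nu,(n+1)u])`, because on the cell
`|f((n+1)u) − f(t)| ≤ Var(f; cell)`. [cite: ConnesConsani2023, Lemma 6.1 (i), proof (arXiv chunk p0018:L32–L43)] -/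
private theorem cell_estimate (hf : RiemannSumHyp f) {u : ℝ} (hu : 0 < u) (n : ℕ) :
    |u * f ((((n + 1 : ℕ) : ℝ)) * u) - ∫ t in Ioc ((n : ℝ) * u) (((n : ℝ) + 1) * u), f t|
      ≤ u * (eVariationOn f (Ioi 0 ∩ Icc ((n : ℝ) * u) (((n : ℝ) + 1) * u))).toReal := by
  set a : ℝ := (n : ℝ) * u with ha
  set b : ℝ := ((n : ℝ) + 1) * u with hb
  have hab : a < b := by rw [ha, hb]; nlinarith
  have ha0 : 0 ≤ a := by positivity
  have hb0 : 0 < b := lt_of_le_of_lt ha0 hab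
  have hcast : (((n + 1 : ℕ) : ℝ)) * u = b := by rw [hb]; push_cast; ring
  rw [hcast]
  have hvol : volume (Ioc a b) = ENNReal.ofReal u := by
    rw [Real.volume_Ioc]; congr 1; rw [ha, hb]; ring
  have hvolr : volume.real (Ioc a b) = u := by rw [measureReal_def, hvol, ENNReal.toReal_ofReal hu.le]
  -- bounded variation on the cell, and the pointwise bound
  have hbv : BoundedVariationOn f (Ioi 0 ∩ Icc a b) := hf.bv.mono inter_subset_left
  have hbound : ∀ t ∈ Ioc a b, ‖f b - f t‖ ≤ (eVariationOn f (Ioi 0 ∩ Icc ((n : ℝ) * u) (((n : ℝ) + 1) * u))).toReal := by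
    intro t ht
    rw [Real.norm_eq_abs, ← Real.dist_eq]
    exact hbv.dist_le ⟨hb0, hab.le, le_rfl⟩ ⟨lt_of_le_of_lt ha0 ht.1, ht.1.le, ht.2⟩
  -- rewrite `u f(b) - ∫ f` as `∫ (f b - f t)`
  have hfi : IntegrableOn f (Ioc a b) := hf.integrable.mono_set fun t ht => lt_of_le_of_lt ha0 ht.1
  have hci : IntegrableOn (fun _ : ℝ => f b) (Ioc a b) := continuous_const.integrableOn_Ioc
  have hrw : u * f b - ∫ t in Ioc a b, f t = ∫ t in Ioc a b, (f b - f t) := by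
    rw [integral_sub hci hfi, setIntegral_const, hvolr, smul_eq_mul]
  rw [hrw, ← Real.norm_eq_abs]
  have h := norm_setIntegral_le_of_norm_le_const (by rw [hvol]; exact ENNReal.ofReal_lt_top) hbound
  rw [hvolr] at h
  linarith [h]

/-- **The Riemann-sum estimate for functions of bounded variation** (proof of Lemma 6.1 (i), p0018:L26–L48):
for `u > 0`, `|u Σ_{n ≥ 1} f(nu) − ∫_0^∞ f| ≤ u · Var(f; (0,∞))`.
[cite: ConnesConsani2023, Lemma 6.1 (i), proof (arXiv chunk p0018:L26–L48)] -/
theorem abs_mul_tsum_sub_integral_le (hf : RiemannSumHyp f) {u : ℝ} (hu : 0 < u) :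
    |u * ∑' n : ℕ, f (((n + 1 : ℕ) : ℝ) * u) - ∫ t in Ioi 0, f t|
      ≤ u * (eVariationOn f (Ioi 0)).toReal := by
  have hV : eVariationOn f (Ioi 0) ≠ ∞ := hf.bv
  -- the summable families
  have ha : HasSum (fun n : ℕ => ∫ t in Ioc ((n : ℝ) * u) (((n : ℝ) + 1) * u), f t) (∫ t in Ioi 0, f t) :=
    hasSum_setIntegral_Ioc_mul_nat hf.integrable hu
  have hb : HasSum (fun n : ℕ => u * f (((n + 1 : ℕ) : ℝ) * u)) (u * ∑' n : ℕ, f (((n + 1 : ℕ) : ℝ) * u)) :=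
    (hf.summable_comp_mul hu).hasSum.mul_left u
  have hW : ∑' n : ℕ, eVariationOn f (Ioi 0 ∩ Icc ((n : ℝ) * u) (((n : ℝ) + 1) * u)) ≠ ∞ :=
    ne_top_of_le_ne_top hV (tsum_cellVar_le hu)
  have hWn : ∀ n : ℕ, eVariationOn f (Ioi 0 ∩ Icc ((n : ℝ) * u) (((n : ℝ) + 1) * u)) ≠ ∞ :=
    fun n => ENNReal.ne_top_of_tsum_ne_top hW n
  have hd : HasSum (fun n : ℕ => u * (eVariationOn f (Ioi 0 ∩ Icc ((n : ℝ) * u) (((n : ℝ) + 1) * u))).toReal) (u * (∑' n : ℕ, eVariationOn f (Ioi 0 ∩ Icc ((n : ℝ) * u) (((n : ℝ) + 1) * u))).toReal) := by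
    rw [ENNReal.tsum_toReal_eq hWn]
    exact (ENNReal.summable_toReal hW).hasSum.mul_left u
  rw [← (hb.sub ha).tsum_eq, ← Real.norm_eq_abs]
  refine (tsum_of_norm_bounded hd fun n => ?_).trans ?_
  · rw [Real.norm_eq_abs]
    exact cell_estimate hf hu n
  · exact mul_le_mul_of_nonneg_left (ENNReal.toReal_mono hV (tsum_cellVar_le hu)) hu.le

/-- With `∫_0^∞ f = 0`: `|Σ_{n ≥ 1} f(nu)| ≤ Var(f; (0,∞))` for every `u > 0` (p0018:L48).
[cite: ConnesConsani2023, Lemma 6.1 (i) (arXiv chunk p0018:L48)] -/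
theorem abs_tsum_le (hf : RiemannSumHyp f) {u : ℝ} (hu : 0 < u) :
    |∑' n : ℕ, f (((n + 1 : ℕ) : ℝ) * u)| ≤ (eVariationOn f (Ioi 0)).toReal := by
  have h := hf.abs_mul_tsum_sub_integral_le hu
  rw [hf.integral_zero, sub_zero, abs_mul, abs_of_pos hu] at h
  exact le_of_mul_le_mul_left h hu

/-- **Lemma 6.1 (i), `𝓔(f) = O(u^{1/2})`**, in the global form `|𝓔(f)(u)| ≤ Var(f; (0,∞)) · u^{1/2}` for
all `u > 0`. [cite: ConnesConsani2023, Lemma 6.1 (i) (arXiv chunk p0018:L23–L24, L51)] -/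
theorem abs_connesE_le (hf : RiemannSumHyp f) {u : ℝ} (hu : 0 < u) :
    |connesE f u| ≤ (eVariationOn f (Ioi 0)).toReal * Real.sqrt u := by
  rw [connesE, abs_mul, abs_of_nonneg (Real.sqrt_nonneg u), mul_comm]
  gcongr
  exact hf.abs_tsum_le hu

/-- `𝓔(f) = O(u^{1/2})` as `u → 0⁺`. [cite: ConnesConsani2023, Lemma 6.1 (i) (arXiv chunk p0018:L23–L24)] -/
theorem connesE_isBigO_nhdsGT (hf : RiemannSumHyp f) :
    connesE f =O[𝓝[>] 0] fun u => Real.sqrt u := by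
  refine IsBigO.of_bound (eVariationOn f (Ioi 0)).toReal ?_
  filter_upwards [self_mem_nhdsWithin] with u hu
  rw [Real.norm_eq_abs, Real.norm_of_nonneg (Real.sqrt_nonneg u)]
  exact hf.abs_connesE_le hu

/-! ### (i), rapid decay of `𝓔(f)` at `∞` -/

/-- A global decay bound: there are `C ≥ 0`, `X ≥ 1` with `|𝓔(f)(u)| ≤ C / u^N` for `u ≥ X`
(from `|f(x)| ≤ C' x^{-(N+2)}` for large `x`, p0018:L51–L57). [cite: ConnesConsani2023, Lemma 6.1 (i), proof (arXiv chunk p0018:L51–L57)] -/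
theorem exists_abs_connesE_le_div_pow (hf : RiemannSumHyp f) (N : ℕ) :
    ∃ C X : ℝ, 0 ≤ C ∧ 1 ≤ X ∧ ∀ u, X ≤ u → |connesE f u| ≤ C / u ^ N := by
  obtain ⟨C, X, hC0, hX1, hb⟩ := hf.exists_bound_of_decay (N + 2)
  set Z : ℝ := ∑' n : ℕ, 1 / (((n + 1 : ℕ) : ℝ)) ^ (N + 2) with hZ
  have hZsum : HasSum (fun n : ℕ => 1 / (((n + 1 : ℕ) : ℝ)) ^ (N + 2)) Z := by
    have h := (summable_nat_add_iff (f := fun n : ℕ => 1 / ((n : ℝ)) ^ (N + 2)) 1).mpr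
      (Real.summable_one_div_nat_pow.mpr (by omega))
    exact h.hasSum
  have hZ0 : 0 ≤ Z := hZsum.nonneg fun n => by positivity
  refine ⟨C * Z, X, mul_nonneg hC0 hZ0, hX1, fun u hu => ?_⟩
  have hu1 : 1 ≤ u := le_trans hX1 hu
  have hu0 : 0 < u := lt_of_lt_of_le zero_lt_one hu1
  -- `|Σ f((n+1)u)| ≤ C Z / u^(N+2)`
  have hS : |∑' n : ℕ, f (((n + 1 : ℕ) : ℝ) * u)| ≤ C * Z / u ^ (N + 2) := by
    rw [← Real.norm_eq_abs]
    have hg : HasSum (fun n : ℕ => C / u ^ (N + 2) * (1 / (((n + 1 : ℕ) : ℝ)) ^ (N + 2)))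
        (C / u ^ (N + 2) * Z) := hZsum.mul_left _
    refine (tsum_of_norm_bounded hg fun n => ?_).trans (le_of_eq (by ring))
    have hn : X ≤ (((n + 1 : ℕ) : ℝ)) * u := by
      have h1 : (1 : ℝ) ≤ ((n + 1 : ℕ) : ℝ) := by exact_mod_cast Nat.succ_pos n
      nlinarith
    rw [Real.norm_eq_abs]
    calc |f ((((n + 1 : ℕ) : ℝ)) * u)| ≤ C / ((((n + 1 : ℕ) : ℝ)) * u) ^ (N + 2) := hb _ hn
      _ = C / u ^ (N + 2) * (1 / (((n + 1 : ℕ) : ℝ)) ^ (N + 2)) := by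
          rw [mul_pow]; field_simp
  -- `√u · C Z / u^(N+2) ≤ C Z / u^N` since `√u ≤ u²`
  rw [connesE, abs_mul, abs_of_nonneg (Real.sqrt_nonneg u)]
  have hsq : Real.sqrt u ≤ u ^ 2 := by
    rw [Real.sqrt_le_left (by positivity)]
    have h2 : u ≤ u ^ 2 := by nlinarith
    have h4 : u ^ 2 ≤ (u ^ 2) ^ 2 := by nlinarith
    exact h2.trans h4
  calc Real.sqrt u * |∑' n : ℕ, f (((n + 1 : ℕ) : ℝ) * u)| ≤ u ^ 2 * (C * Z / u ^ (N + 2)) := by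
        gcongr
    _ = C * Z / u ^ N := by
        rw [pow_add]; field_simp

/-- **Lemma 6.1 (i), rapid decay**: `𝓔(f) = O(u^{-N})` at `+∞` for every `N`.
[cite: ConnesConsani2023, Lemma 6.1 (i) (arXiv chunk p0018:L23–L24, L51–L57)] -/
theorem connesE_isBigO_atTop (hf : RiemannSumHyp f) (N : ℕ) :
    connesE f =O[atTop] fun u => u ^ (-(N : ℝ)) := by
  obtain ⟨C, X, hC0, hX1, hb⟩ := hf.exists_abs_connesE_le_div_pow N
  refine IsBigO.of_bound C ?_
  filter_upwards [eventually_ge_atTop X] with u hu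
  have hu0 : 0 < u := lt_of_lt_of_le zero_lt_one (le_trans hX1 hu)
  rw [Real.norm_eq_abs, Real.norm_of_nonneg (Real.rpow_nonneg hu0.le _), Real.rpow_neg hu0.le,
    Real.rpow_natCast, ← div_eq_mul_inv]
  exact hb u hu

/-! ### (ii): the series `Σ_{k ∈ ℤ} 𝓔(f)(μ^k u)` -/

/-- Two-sided bound: `|𝓔(f)(v)| ≤ M √v` and `|𝓔(f)(v)| ≤ M / √v` for all `v > 0`
(`O(u^{1/2})` at `0`, decay at `∞`). [cite: ConnesConsani2023, Lemma 6.1 (i) (arXiv chunk p0018:L23–L24)] -/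
theorem exists_abs_connesE_le_two_sided (hf : RiemannSumHyp f) :
    ∃ M : ℝ, 0 ≤ M ∧ ∀ v, 0 < v → |connesE f v| ≤ M * Real.sqrt v ∧ |connesE f v| ≤ M / Real.sqrt v := by
  set V : ℝ := (eVariationOn f (Ioi 0)).toReal with hV
  have hV0 : 0 ≤ V := ENNReal.toReal_nonneg
  obtain ⟨C, X, hC0, hX1, hb⟩ := hf.exists_abs_connesE_le_div_pow 1
  refine ⟨V * X + C, by positivity, fun v hv => ⟨?_, ?_⟩⟩
  · calc |connesE f v| ≤ V * Real.sqrt v := hf.abs_connesE_le hv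
      _ ≤ (V * X + C) * Real.sqrt v := by
          gcongr; nlinarith
  · have hsv : 0 < Real.sqrt v := Real.sqrt_pos.2 hv
    rw [le_div_iff₀ hsv]
    rcases le_or_gt X v with hXv | hXv
    · -- `v ≥ X ≥ 1`: `|𝓔 f v| √v ≤ (C / v) √v ≤ C`
      have hv1 : 1 ≤ v := le_trans hX1 hXv
      have hsq : Real.sqrt v ≤ v := by
        rw [Real.sqrt_le_left hv.le]; nlinarith
      calc |connesE f v| * Real.sqrt v ≤ C / v ^ 1 * Real.sqrt v := by
            gcongr; exact hb v hXv
        _ ≤ C / v ^ 1 * v := by gcongr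
        _ = C := by rw [pow_one]; field_simp
        _ ≤ V * X + C := by nlinarith
    · -- `v < X`: `|𝓔 f v| √v ≤ V √v √v = V v ≤ V X`
      calc |connesE f v| * Real.sqrt v ≤ V * Real.sqrt v * Real.sqrt v := by
            gcongr; exact hf.abs_connesE_le hv
        _ = V * v := by rw [mul_assoc, Real.mul_self_sqrt hv.le]
        _ ≤ V * X + C := by nlinarith

/-- `√(e^{y} v) = e^{y/2} √v`. [folklore] -/
private theorem sqrt_exp_mul (y v : ℝ) :
    Real.sqrt (Real.exp y * v) = Real.exp (y / 2) * Real.sqrt v := by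
  rw [Real.sqrt_mul (Real.exp_pos y).le, ← Real.exp_half]

/-- **Lemma 6.1 (ii), convergence**: for `μ = e^L > 1` and `u > 0` the series `Σ_{k ∈ ℤ} 𝓔(f)(μ^k u)`
converges ("geometrically": for `k ≤ 0`, `|𝓔(f)(μ^k u)| ≤ C μ^{k/2}`, p0018:L57–L58; for `k > 0` by the decay
at `∞`). [cite: ConnesConsani2023, Lemma 6.1 (ii) (arXiv chunk p0018:L24, L57–L58)] -/
theorem summable_connesE_zpow_mul (hf : RiemannSumHyp f) {L : ℝ} (hL : 0 < L) {u : ℝ} (hu : 0 < u) :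
    Summable fun k : ℤ => connesE f (Real.exp L ^ k * u) := by
  obtain ⟨M, hM0, hM⟩ := hf.exists_abs_connesE_le_two_sided
  have hq : Real.exp (-(L / 2)) < 1 := Real.exp_lt_one_iff.2 (by linarith)
  have hq0 : 0 ≤ Real.exp (-(L / 2)) := (Real.exp_pos _).le
  have hgeom : Summable fun n : ℕ => Real.exp (-(L / 2)) ^ n := summable_geometric_of_lt_one hq0 hq
  have hpow : ∀ n : ℕ, Real.exp (-(L / 2)) ^ n = Real.exp (-((n : ℝ) * L) / 2) := by
    intro n; rw [← Real.exp_nat_mul]; congr 1; ring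
  refine Summable.of_nat_of_neg ?_ ?_
  · -- `k = n ≥ 0`: `|𝓔 f (e^{nL} u)| ≤ M / √(e^{nL} u) = (M / √u) e^{-nL/2}`
    refine Summable.of_norm_bounded (g := fun n : ℕ => M / Real.sqrt u * Real.exp (-(L / 2)) ^ n)
      (hgeom.mul_left _) fun n => ?_
    have hv : 0 < Real.exp L ^ n * u := by positivity
    rw [Real.norm_eq_abs, zpow_natCast]
    refine (hM _ hv).2.trans (le_of_eq ?_)
    rw [← Real.exp_nat_mul, sqrt_exp_mul _ u, hpow n]
    have hsu : Real.sqrt u ≠ 0 := (Real.sqrt_pos.2 hu).ne'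
    field_simp
    rw [mul_assoc, ← Real.exp_add, show (n : ℝ) * L / 2 + -((n : ℝ) * L / 2) = 0 by ring, Real.exp_zero,
      mul_one]
  · -- `k = -n`: `|𝓔 f (e^{-nL} u)| ≤ M √(e^{-nL} u) = M √u e^{-nL/2}`
    refine Summable.of_norm_bounded (g := fun n : ℕ => M * Real.sqrt u * Real.exp (-(L / 2)) ^ n)
      (hgeom.mul_left _) fun n => ?_
    have hv : 0 < Real.exp L ^ (-(n : ℤ)) * u := by positivity
    rw [Real.norm_eq_abs]
    refine (hM _ hv).1.trans (le_of_eq ?_)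
    rw [zpow_neg, zpow_natCast, ← Real.exp_nat_mul, ← Real.exp_neg, sqrt_exp_mul _ u, hpow n]
    ring_nf

/-- Scale invariance of `Σ_μ` by integer powers: `(Σ_μ g)(μ^m u) = (Σ_μ g)(u)`. [folklore] -/
private theorem scaleSum_zpow_mul {μ : ℝ} (hμ : μ ≠ 0) (g : ℝ → ℝ) (m : ℤ) (u : ℝ) :
    scaleSum μ g (μ ^ m * u) = scaleSum μ g u := by
  unfold scaleSum
  have h : (fun k : ℤ => g (μ ^ k * (μ ^ m * u))) = fun k : ℤ => (fun j : ℤ => g (μ ^ j * u)) (k + m) := by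
    funext k
    simp only [zpow_add₀ hμ, mul_assoc]
  rw [h]
  exact (Equiv.addRight m).tsum_eq (fun j : ℤ => g (μ ^ j * u))

/-- **Lemma 6.1 (ii), boundedness**: `Σ_μ 𝓔(f)` is bounded on `ℝ₊^*` (by scale invariance it suffices to
bound it on a period `[1, μ)`, where the series is dominated by a fixed geometric series).
[cite: ConnesConsani2023, Lemma 6.1 (ii) (arXiv chunk p0018:L24, L57–L58)] -/
theorem exists_abs_scaleSum_le (hf : RiemannSumHyp f) {L : ℝ} (hL : 0 < L) :
    ∃ C : ℝ, ∀ u, 0 < u → |scaleSum (Real.exp L) (connesE f) u| ≤ C := by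
  obtain ⟨M, hM0, hM⟩ := hf.exists_abs_connesE_le_two_sided
  have hq : Real.exp (-(L / 2)) < 1 := Real.exp_lt_one_iff.2 (by linarith)
  have hq0 : 0 ≤ Real.exp (-(L / 2)) := (Real.exp_pos _).le
  have hgeom : Summable fun n : ℕ => Real.exp (-(L / 2)) ^ n := summable_geometric_of_lt_one hq0 hq
  have hpow : ∀ n : ℕ, Real.exp (-(L / 2)) ^ n = Real.exp (-((n : ℝ) * L) / 2) := by
    intro n; rw [← Real.exp_nat_mul]; congr 1; ring
  -- the dominating family `b k = M e^{L/2} e^{-|k| L/2}` and its sum `B`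
  set b : ℤ → ℝ := fun k => M * Real.exp (L / 2) * Real.exp (-(L / 2)) ^ k.natAbs with hb
  obtain ⟨B, hB⟩ : ∃ B, HasSum b B := by
    have e1 : (fun n : ℕ => b n) = fun n : ℕ => M * Real.exp (L / 2) * Real.exp (-(L / 2)) ^ n := by
      funext n; simp only [hb, Int.natAbs_natCast]
    have e2 : (fun n : ℕ => b (-(n + 1))) = fun n : ℕ => M * Real.exp (L / 2) * Real.exp (-(L / 2)) ^ (n + 1) := by
      funext n
      simp only [hb]
      rw [Int.natAbs_neg, show ((n : ℤ) + 1) = ((n + 1 : ℕ) : ℤ) by push_cast; ring, Int.natAbs_natCast]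
    have h1 : HasSum (fun n : ℕ => b n) (∑' n : ℕ, M * Real.exp (L / 2) * Real.exp (-(L / 2)) ^ n) := by
      rw [e1]; exact (hgeom.mul_left _).hasSum
    have h2 : HasSum (fun n : ℕ => b (-(n + 1)))
        (∑' n : ℕ, M * Real.exp (L / 2) * Real.exp (-(L / 2)) ^ (n + 1)) := by
      rw [e2]
      exact (((hgeom.mul_left (Real.exp (-(L / 2)))).mul_left (M * Real.exp (L / 2))).congr
        fun n => by ring).hasSum
    exact ⟨_, h1.of_nat_of_neg_add_one h2⟩
  refine ⟨B, fun u hu => ?_⟩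
  -- reduce to `u₀ ∈ [1, e^L)`
  set m : ℤ := ⌊Real.log u / L⌋ with hm
  set u₀ : ℝ := Real.exp (Real.log u - m * L) with hu₀
  have hu₀1 : 1 ≤ u₀ := by
    rw [hu₀, ← Real.exp_zero]
    apply Real.exp_le_exp.2
    have := Int.floor_le (Real.log u / L)
    rw [← hm] at this
    have : (m : ℝ) * L ≤ Real.log u := by rwa [le_div_iff₀ hL] at this
    linarith
  have hu₀2 : u₀ ≤ Real.exp L := by
    rw [hu₀]
    apply Real.exp_le_exp.2
    have := Int.lt_floor_add_one (Real.log u / L)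
    rw [← hm] at this
    have : Real.log u < ((m : ℝ) + 1) * L := by rwa [div_lt_iff₀ hL] at this
    linarith
  have hu₀0 : 0 < u₀ := Real.exp_pos _
  have hzpow : Real.exp L ^ m = Real.exp ((m : ℝ) * L) := by
    rw [← Real.rpow_intCast, ← Real.exp_mul, mul_comm]
  have hueq : u = Real.exp L ^ m * u₀ := by
    rw [hzpow, hu₀, ← Real.exp_add, show (m : ℝ) * L + (Real.log u - m * L) = Real.log u by ring,
      Real.exp_log hu]
  rw [hueq, scaleSum_zpow_mul (Real.exp_pos L).ne', scaleSum, ← Real.norm_eq_abs]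
  refine tsum_of_norm_bounded hB fun k => ?_
  rw [Real.norm_eq_abs]
  rcases Int.natAbs_eq k with hk | hk
  · -- `k = n ≥ 0`: `e^{nL} u₀ ≥ 1`, use the `1/√v` bound
    set n := k.natAbs
    have hbn : b (n : ℤ) = M * Real.exp (L / 2) * Real.exp (-(L / 2)) ^ n := by
      simp only [hb, Int.natAbs_natCast]
    rw [hk, hbn, zpow_natCast]
    have hv : 0 < Real.exp L ^ n * u₀ := by positivity
    refine (hM _ hv).2.trans ?_
    rw [div_le_iff₀ (Real.sqrt_pos.2 hv), show Real.exp L ^ n = Real.exp ((n : ℝ) * L) from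
      (Real.exp_nat_mul L n).symm, sqrt_exp_mul _ u₀, hpow n]
    have h1 : 1 ≤ Real.sqrt u₀ := by rw [← Real.sqrt_one]; exact Real.sqrt_le_sqrt hu₀1
    have hprod : Real.exp (-((n : ℝ) * L) / 2) * Real.exp ((n : ℝ) * L / 2) = 1 := by
      rw [← Real.exp_add, show -((n : ℝ) * L) / 2 + (n : ℝ) * L / 2 = 0 by ring, Real.exp_zero]
    have hle : M ≤ M * Real.exp (L / 2) * Real.sqrt u₀ := by
      calc M = M * 1 * 1 := by ring
        _ ≤ M * Real.exp (L / 2) * Real.sqrt u₀ := by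
            gcongr
            exact Real.one_le_exp (by linarith)
    calc M ≤ M * Real.exp (L / 2) * Real.sqrt u₀ := hle
      _ = M * Real.exp (L / 2) * Real.exp (-((n : ℝ) * L) / 2) * (Real.exp ((n : ℝ) * L / 2) * Real.sqrt u₀) := by
          linear_combination (-(M * Real.exp (L / 2) * Real.sqrt u₀)) * hprod
  · -- `k = -(n)` with `n = |k| ≥ 1`... : `e^{-nL} u₀ ≤ e^{-(n-1)L}`, use the `√v` bound
    set n := k.natAbs
    have hbn : b (-(n : ℤ)) = M * Real.exp (L / 2) * Real.exp (-(L / 2)) ^ n := by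
      simp only [hb, Int.natAbs_neg, Int.natAbs_natCast]
    rw [hk, hbn, zpow_neg, zpow_natCast]
    have hv : 0 < (Real.exp L ^ n)⁻¹ * u₀ := by positivity
    refine (hM _ hv).1.trans ?_
    rw [show Real.exp L ^ n = Real.exp ((n : ℝ) * L) from (Real.exp_nat_mul L n).symm, ← Real.exp_neg,
      sqrt_exp_mul _ u₀, hpow n]
    have h1 : Real.sqrt u₀ ≤ Real.exp (L / 2) := by
      rw [Real.exp_half]; exact Real.sqrt_le_sqrt hu₀2
    calc M * (Real.exp (-((n : ℝ) * L) / 2) * Real.sqrt u₀)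
        ≤ M * (Real.exp (-((n : ℝ) * L) / 2) * Real.exp (L / 2)) := by gcongr
      _ = M * Real.exp (L / 2) * Real.exp (-((n : ℝ) * L) / 2) := by ring

/-! ### (ii), measurability of `Σ_μ 𝓔(f)` on the circle -/

/-- For `p` monotone on `(0,∞)` and `c > 0`, `x ↦ p(c eˣ)` is monotone on `ℝ`, hence measurable. [folklore] -/
private theorem measurable_comp_mul_exp_of_monotoneOn {p : ℝ → ℝ} (hp : MonotoneOn p (Ioi 0)) {c : ℝ}
    (hc : 0 < c) : Measurable fun x : ℝ => p (c * Real.exp x) := by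
  refine Monotone.measurable fun x y hxy => hp ?_ ?_ ?_
  · exact mul_pos hc (Real.exp_pos x)
  · exact mul_pos hc (Real.exp_pos y)
  · exact mul_le_mul_of_nonneg_left (Real.exp_le_exp.2 hxy) hc.le

/-- `x ↦ f(c eˣ)` is measurable (`c > 0`): a function of bounded variation on `(0,∞)` is a difference of
two monotone functions there. [folklore] -/
private theorem measurable_comp_mul_exp (hf : RiemannSumHyp f) {c : ℝ} (hc : 0 < c) :
    Measurable fun x : ℝ => f (c * Real.exp x) := by
  obtain ⟨p, q, hp, hq, hfpq⟩ := hf.bv.locallyBoundedVariationOn.exists_monotoneOn_sub_monotoneOn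
  have h : (fun x : ℝ => f (c * Real.exp x)) = fun x => p (c * Real.exp x) - q (c * Real.exp x) := by
    funext x; rw [hfpq]; rfl
  rw [h]
  exact (measurable_comp_mul_exp_of_monotoneOn hp hc).sub (measurable_comp_mul_exp_of_monotoneOn hq hc)

/-- `x ↦ 𝓔(f)(c eˣ)` is measurable (`c > 0`): a pointwise limit of finite sums of measurable functions.
[folklore] -/
private theorem measurable_connesE_comp_mul_exp (hf : RiemannSumHyp f) {c : ℝ} (hc : 0 < c) :
    Measurable fun x : ℝ => connesE f (c * Real.exp x) := by
  unfold connesE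
  refine (Real.continuous_sqrt.measurable.comp (measurable_const.mul Real.measurable_exp)).mul ?_
  refine measurable_of_tendsto_metrizable
    (f := fun N x => ∑ n ∈ Finset.range N, f (((n + 1 : ℕ) : ℝ) * (c * Real.exp x))) ?_ ?_
  · intro N
    refine Finset.measurable_sum _ fun n _ => ?_
    have h : (fun x => f (((n + 1 : ℕ) : ℝ) * (c * Real.exp x))) =
        fun x => f ((((n + 1 : ℕ) : ℝ) * c) * Real.exp x) := by
      funext x; rw [mul_assoc]
    rw [h]
    exact measurable_comp_mul_exp hf (by positivity)
  · rw [tendsto_pi_nhds]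
    intro x
    exact (hf.summable_comp_mul (mul_pos hc (Real.exp_pos x))).hasSum.tendsto_sum_nat

/-- **Lemma 6.1 (ii), measurability**: `Σ_μ 𝓔(f)` is a measurable function on `ℝ₊^*/μ^ℤ` (on `ℝ` it is the
pointwise limit of the finite partial sums over `k`; the circle carries the quotient σ-algebra).
[cite: ConnesConsani2023, Lemma 6.1 (ii) (arXiv chunk p0018:L24)] -/
theorem measurable_sigmaE (hf : RiemannSumHyp f) {L : ℝ} (hL : 0 < L) : Measurable (sigmaE L f) := by
  have hreal : Measurable fun x : ℝ => scaleSum (Real.exp L) (connesE f) (Real.exp x) := by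
    unfold scaleSum
    refine measurable_of_tendsto_metrizable' (atTop : Filter (Finset ℤ))
      (f := fun s x => ∑ k ∈ s, connesE f (Real.exp L ^ k * Real.exp x)) (fun s => ?_) ?_
    · refine Finset.measurable_sum _ fun k _ => ?_
      exact measurable_connesE_comp_mul_exp hf (zpow_pos (Real.exp_pos L) k)
    · rw [tendsto_pi_nhds]
      intro x
      exact (hf.summable_connesE_zpow_mul hL (Real.exp_pos x)).hasSum
  have hcomp : Measurable fun x : ℝ => sigmaE L f (x : AddCircle L) := by
    have h : (fun x : ℝ => sigmaE L f (x : AddCircle L)) =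
        fun x => ((scaleSum (Real.exp L) (connesE f) (Real.exp x) : ℝ) : ℂ) := by
      funext x; exact sigmaE_coe L f x
    rw [h]
    exact Complex.measurable_ofReal.comp hreal
  exact measurable_from_quotient.2 hcomp

end RiemannSumHyp

/-- **Lemma 6.1 of Connes–Consani 2023** (discharge of the named fact `CC2023_lemma_6_1`).  RH-FREE;
nothing here bears on the truth of RH. [cite: ConnesConsani2023, Lemma 6.1 (arXiv chunk p0018:L23–L58)] -/
theorem CC2023_lemma_6_1_holds : CC2023_lemma_6_1 := by
  intro f hf
  exact ⟨⟨fun u hu => hf.summable_comp_mul hu, hf.connesE_isBigO_nhdsGT, hf.connesE_isBigO_atTop⟩,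
    fun L hL => ⟨fun u hu => hf.summable_connesE_zpow_mul hL hu, hf.exists_abs_scaleSum_le hL,
      hf.measurable_sigmaE hL⟩⟩

end Literature.NumberTheory.ConnesConsani2023.ZetaCycles
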